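import Summits.Ventures.HodgeRepro2.T5CornerSimple
import Summits.Ventures.HodgeRepro2.T5CornerSmooth
import Summits.Ventures.HodgeRepro2.T5DirectedIdempotents

/-!
# The corner functor is representable: `Hom_R(Re, M) ≃ e M` (Tier-5 kernel support, p8)

For a ring `R`, an idempotent `e` and a module `M`, evaluation at `e` identifies the `R`-linear
maps from the left ideal `Re = R ∙ e` to `M` with the corner `e M = {m | e • m = m}`
(`homCornerEquiv`), naturally in `M` (`evalAt_comp`) — the sentence «the functor `π ↦ π^K =
e_K π` is represented by `H(G) e_K`» of the Hecke dictionary, at the level of an abstract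
idempotent.  The file also bridges the two formulations of non-degeneracy on this seat's
record: the set form `IsNondegenerate` of `T5DirectedIdempotents` and the indexed form
`IsSmoothModule` of `T5CornerSmooth` agree for `E = range e`
(`isNondegenerate_range_iff_isSmoothModule`), and a monotone family of idempotents indexed by a
directed preorder is a directed family in the set sense (`isDirectedIdempotents_range`).
-/

namespace Summit.Ventures.HodgeRepro2.T5CornerRepresentable

open Summit.Ventures.HodgeRepro2.T5CornerSimple Summit.Ventures.HodgeRepro2.T5CornerSmooth
  Summit.Ventures.HodgeRepro2.T5DirectedIdempotents

section Representable

variable {R : Type*} [Ring R] {M : Type*} [AddCommGroup M] [Module R M] {e : R}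
  (he : IsIdempotentElem e)

/-- `e` lies in the left ideal `R ∙ e`. -/
theorem self_mem_span : e ∈ (R ∙ e) :=
  Submodule.mem_span_singleton_self e

/-- Evaluation at `e`: `Hom_R(Re, M) → e M`. -/
def evalAt (f : (R ∙ e) →ₗ[R] M) : cornerModule e M :=
  ⟨f ⟨e, self_mem_span⟩, by
    rw [mem_cornerModule_iff he, ← map_smul]
    congr 1
    exact Subtype.ext (by simp [he.eq])⟩

/-- The underlying vector of `evalAt he f` is `f e`. -/
@[simp] theorem coe_evalAt (f : (R ∙ e) →ₗ[R] M) : (evalAt he f : M) = f ⟨e, self_mem_span⟩ :=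
  rfl

/-- A vector `m ∈ e M` gives the `R`-linear map `x ↦ x • m : Re → M`. -/
def cornerToHom (m : cornerModule e M) : (R ∙ e) →ₗ[R] M where
  toFun x := (x : R) • (m : M)
  map_add' x y := by simp only [Submodule.coe_add, add_smul]
  map_smul' r x := by simp only [Submodule.coe_smul, smul_eq_mul, mul_smul, RingHom.id_apply]

/-- `cornerToHom m x = x • m`. -/
@[simp] theorem cornerToHom_apply (m : cornerModule e M) (x : R ∙ e) : cornerToHom m x = (x : R) • (m : M) :=
  rfl

/-- `evalAt ∘ cornerToHom = id`. -/
theorem evalAt_cornerToHom (m : cornerModule e M) : evalAt he (cornerToHom m) = m := by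
  apply Subtype.ext
  show e • (m : M) = m
  exact (mem_cornerModule_iff he).1 m.2

/-- `cornerToHom ∘ evalAt = id`: an `R`-linear map on `Re` is determined by its value at `e`. -/
theorem cornerToHom_evalAt (f : (R ∙ e) →ₗ[R] M) : cornerToHom (evalAt he f) = f := by
  refine LinearMap.ext fun x => ?_
  obtain ⟨x, hx⟩ := x
  obtain ⟨r, rfl⟩ := Submodule.mem_span_singleton.1 hx
  have hfix : e • f ⟨e, self_mem_span⟩ = f ⟨e, self_mem_span⟩ :=
    (mem_cornerModule_iff he).1 (evalAt he f).2
  have hx' : (⟨r • e, hx⟩ : R ∙ e) = r • ⟨e, self_mem_span⟩ := Subtype.ext rfl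
  rw [cornerToHom_apply, coe_evalAt, hx', map_smul, Submodule.coe_smul, smul_eq_mul, mul_smul, hfix]

/-- The representability of the corner functor: `Hom_R(Re, M) ≃ e M` (as additive groups),
`f ↦ f e`, inverse `m ↦ (x ↦ x • m)`. -/
def homCornerEquiv : ((R ∙ e) →ₗ[R] M) ≃+ cornerModule e M where
  toFun := evalAt he
  invFun := cornerToHom
  left_inv := cornerToHom_evalAt he
  right_inv := evalAt_cornerToHom he
  map_add' f g := Subtype.ext (by simp only [coe_evalAt, LinearMap.add_apply, AddSubgroup.coe_add])

/-- `homCornerEquiv` is evaluation at `e`. -/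
@[simp] theorem homCornerEquiv_apply (f : (R ∙ e) →ₗ[R] M) :
    (homCornerEquiv he f : M) = f ⟨e, self_mem_span⟩ :=
  rfl

/-- Naturality of evaluation at `e` in the module: `(g ∘ f) e = g (f e)`. -/
theorem evalAt_comp {N : Type*} [AddCommGroup N] [Module R N] (g : M →ₗ[R] N)
    (f : (R ∙ e) →ₗ[R] M) : (evalAt he (g ∘ₗ f) : N) = g (evalAt he f) := by
  simp only [coe_evalAt, LinearMap.comp_apply]

/-- `g` carries `e M` into `e N`. -/
theorem map_mem_cornerModule {N : Type*} [AddCommGroup N] [Module R N] (g : M →ₗ[R] N)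
    {m : M} (hm : m ∈ cornerModule e M) : g m ∈ cornerModule e N := by
  rw [mem_cornerModule_iff'] at hm ⊢
  obtain ⟨m', rfl⟩ := hm
  exact ⟨g m', (map_smul g e m').symm⟩

include he in
/-- `Hom_R(Re, M) = 0` iff `e M = 0`: the corner detects vanishing of the represented functor. -/
theorem subsingleton_hom_iff : Subsingleton ((R ∙ e) →ₗ[R] M) ↔ Subsingleton (cornerModule e M) :=
  (homCornerEquiv he).toEquiv.subsingleton_congr

end Representable

section Bridge

variable {R : Type*} [Ring R] {ι : Type*} (e : ι → R) {M : Type*} [AddCommGroup M] [Module R M]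

/-- The set form of non-degeneracy (`T5DirectedIdempotents`) over `range e` is the indexed form
(`T5CornerSmooth.IsSmoothModule`). -/
theorem isNondegenerate_range_iff_isSmoothModule :
    IsNondegenerate (Set.range e) M ↔ IsSmoothModule e (M := M) := by
  constructor
  · intro h m
    obtain ⟨_, ⟨i, rfl⟩, hm⟩ := h m
    exact ⟨i, hm⟩
  · intro h m
    obtain ⟨i, hi⟩ := h m
    exact ⟨e i, ⟨i, rfl⟩, hi⟩

variable [Preorder ι]

/-- A monotone family of idempotents indexed by a non-empty directed preorder is a directed
family of idempotents in the set sense. -/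
theorem isDirectedIdempotents_range [Nonempty ι] [IsDirected ι (· ≤ ·)]
    (hidem : ∀ i, IsIdempotentElem (e i))
    (hmono : ∀ i j, i ≤ j → e j * e i = e i ∧ e i * e j = e i) :
    IsDirectedIdempotents (Set.range e) where
  nonempty := ⟨e (Classical.arbitrary ι), ⟨_, rfl⟩⟩
  idem := by
    rintro _ ⟨i, rfl⟩
    exact hidem i
  directed := by
    rintro _ ⟨i, rfl⟩ _ ⟨j, rfl⟩
    obtain ⟨l, hil, hjl⟩ := directed_of (· ≤ ·) i j
    exact ⟨e l, ⟨l, rfl⟩, ⟨(hmono i l hil).2, (hmono i l hil).1⟩,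
      ⟨(hmono j l hjl).2, (hmono j l hjl).1⟩⟩

end Bridge

end Summit.Ventures.HodgeRepro2.T5CornerRepresentable
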